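import Summits.CriticalPhenomena.PercolationContinuityZ3.Theorems.PercNearOneGluingNoHeavyLowerTailThreePartitionCubeMasks
import Summits.CriticalPhenomena.PercolationContinuityZ3.Theorems.PercNearOneGluingNoHeavyLowerTailThreePartitionCubeTables
import Summits.CriticalPhenomena.PercolationContinuityZ3.Theorems.PercNearOneGluingNoHeavyLowerTailThreePartitionCubeProfile
import Summits.CriticalPhenomena.PercolationContinuityZ3.Theorems.PercNearOneGluingNoHeavyLowerTailThreePartitionCubeOrder

/-!
# Twisted three-partition positivity (★★) = (M⁺-3) on SIX letters: soundness of the checker, VIII — **the DICTIONARY**: the masks of a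
# represented 2-coloured antichain are the up-sets of the conditioned pair

Support file (cell `prim-sahi`, seat `prim-sahi-typer` gen 34/35; `--supports stmt-CriticalPhenomena-4575`).  Pure proofs plus one bookkeeping
predicate (`Repr`); no `sorry`, standard axioms.
* sizes: `classDown_lt`, `full_lt`, `cU_lt`, `cV_lt`, `dFOf_lt` (the masks of `…CubeMasks` fit a 64-bit lane when `2^m ≤ 64`);
* `Repr m A B pts mm` — the code array `pts` (codes `< 2^m`) with the colouring `mm` REPRESENTS the pair `(A, B)`: the points of the first
  colour class are exactly `coGen A`, those of the second exactly `coGen B`;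
* bits of the derived masks: `testBit_classDown`, `testBit_cU_iff` / `testBit_cV_iff`, `testBit_freeOf_iff`, `testBit_dFOf_of_free`;
* **`cU_eq_encA` / `cV_eq_encA`** — under `Repr`, `cU m pts mm = encA m ↑A` and `cV m pts mm = encA m ↑B` (up-sets are the complements of
  the down-sets of their co-generators: `PairSat.not_mem_iff_exists_coGen_ge`);
* `free_iff_testBit_freeOf` — the free points of the node are the `PairSat.Free (coGen A ∪ coGen B)` points; `testBit_dFOf_of_le_free` —
  every code below a free point is in `dFOf`.
That a GOOD triple puts the profile in the relative dual cone (`inDualRel_of_good`) is proved in `…CubeNormal`. [this work]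
-/

namespace Summit.CriticalPhenomena.PercolationContinuityZ3.Theorems.ThreePartition.Cube

open Finset SahiGridPattern.Pair43 SahiC3Cube
open scoped Classical symmDiff

variable {m : ℕ}

/-! ### Sizes of the tables and masks -/

/-- Entries of an `Array.ofFn` table are bounded by a bound of its values (default `0`). [this work] -/
theorem getD_ofFn_lt {n B : ℕ} (f : Fin n → ℕ) (hf : ∀ i, f i < B) (hB : 0 < B) (a : ℕ) : (Array.ofFn f).getD a 0 < B := by
  rw [Array.getD_eq_getD_getElem?, Array.getElem?_ofFn]
  split
  · exact hf _
  · exact hB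

/-- `subT` entries are `< 2^(2^m)`. [this work] -/
theorem subT_getD_lt (m a : ℕ) : (mkTabs m).subT.getD a 0 < 2 ^ (2 ^ m) := by
  have h1 : (mkTabs m).subT = Array.ofFn fun a : Fin (1 <<< m) => maskOfN (1 <<< m) fun b => sub b a := rfl
  have h3 : (2 : ℕ) ^ (1 <<< m) = 2 ^ (2 ^ m) := by rw [Nat.one_shiftLeft]
  rw [h1]
  exact getD_ofFn_lt _ (fun i => h3 ▸ maskOfN_lt _ _) (by positivity) a

/-- The class down-set masks are `< 2^(2^m)`. [this work] -/
theorem classDown_lt (m : ℕ) (pts : Array ℕ) (mm : ℕ) :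
    (classDown (mkTabs m) pts mm).1 < 2 ^ (2 ^ m) ∧ (classDown (mkTabs m) pts mm).2 < 2 ^ (2 ^ m) := by
  unfold classDown
  generalize pts.size = n
  induction n with
  | zero => simp only [foldBelow]; exact ⟨by positivity, by positivity⟩
  | succ n ih =>
    rw [foldBelow]
    try dsimp only
    split
    · exact ⟨Nat.or_lt_two_pow ih.1 (subT_getD_lt m _), ih.2⟩
    · exact ⟨ih.1, Nat.or_lt_two_pow ih.2 (subT_getD_lt m _)⟩

/-- `full < 2^(2^m)`. [this work] -/
theorem full_lt (m : ℕ) : (mkTabs m).full < 2 ^ (2 ^ m) := by rw [full_eq]; exact Nat.sub_lt (by positivity) one_pos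

/-- `2^(2^m) ≤ 2^64` when `2^m ≤ 64`. [this work] -/
theorem pow_pow_le_64 {m : ℕ} (hm : 2 ^ m ≤ 64) : (2 : ℕ) ^ (2 ^ m) ≤ 2 ^ 64 := Nat.pow_le_pow_right (by norm_num) hm

/-- `cU < 2^64`. [this work] -/
theorem cU_lt {m : ℕ} (hm : 2 ^ m ≤ 64) (pts : Array ℕ) (mm : ℕ) : cU m pts mm < 2 ^ 64 :=
  (Nat.xor_lt_two_pow (full_lt m) (classDown_lt m pts mm).1).trans_le (pow_pow_le_64 hm)

/-- `cV < 2^64`. [this work] -/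
theorem cV_lt {m : ℕ} (hm : 2 ^ m ≤ 64) (pts : Array ℕ) (mm : ℕ) : cV m pts mm < 2 ^ 64 :=
  (Nat.xor_lt_two_pow (full_lt m) (classDown_lt m pts mm).2).trans_le (pow_pow_le_64 hm)

/-- `orBits` of `subT` is `< 2^(2^m)`. [this work] -/
theorem orBits_subT_lt (m mask : ℕ) : orBits (mkTabs m) (mkTabs m).subT mask < 2 ^ (2 ^ m) := by
  unfold orBits
  generalize (mkTabs m).np = n
  induction n with
  | zero => simp only [foldBelow]; positivity
  | succ n ih =>
    rw [foldBelow]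
    try dsimp only
    split
    · exact Nat.or_lt_two_pow ih (subT_getD_lt m _)
    · exact ih

/-- `dFOf < 2^64`. [this work] -/
theorem dFOf_lt {m : ℕ} (hm : 2 ^ m ≤ 64) (pts : Array ℕ) : dFOf m pts < 2 ^ 64 := (orBits_subT_lt m _).trans_le (pow_pow_le_64 hm)

/-! ### Bits of the class down-sets and of the up-set masks -/

/-- Bits of the two class down-set masks. [this work] -/
theorem testBit_classDown (pts : Array ℕ) (mm y : ℕ) :
    ((classDown (mkTabs m) pts mm).1.testBit y =
        (List.range pts.size).any fun j => inFirst mm j && ((mkTabs m).subT.getD (pts.getD j 0) 0).testBit y) ∧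
      ((classDown (mkTabs m) pts mm).2.testBit y =
        (List.range pts.size).any fun j => !inFirst mm j && ((mkTabs m).subT.getD (pts.getD j 0) 0).testBit y) := by
  unfold classDown
  generalize pts.size = n
  induction n with
  | zero => simp [foldBelow]
  | succ n ih =>
    obtain ⟨ih1, ih2⟩ := ih
    rw [foldBelow]
    dsimp only at ih1 ih2 ⊢
    rw [List.range_succ, List.any_append, List.any_append, List.any_cons, List.any_nil, List.any_cons, List.any_nil, Bool.or_false,
      Bool.or_false]
    cases hf : inFirst mm n
    · rw [if_neg Bool.false_ne_true]
      dsimp only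
      rw [Nat.testBit_or, ih1, ih2]
      constructor
      · simp
      · simp
    · rw [if_pos rfl]
      dsimp only
      rw [Nat.testBit_or, ih1, ih2]
      constructor
      · simp
      · simp

/-- The codes of the node are below `2^m`. [this work] -/
def PtsLt (m : ℕ) (pts : Array ℕ) : Prop := ∀ j < pts.size, pts.getD j 0 < 2 ^ m

/-- Bits of `cU` (codes `< 2^m`): not below a first-class point. [this work] -/
theorem testBit_cU_iff {pts : Array ℕ} (hpts : PtsLt m pts) (mm : ℕ) {y : ℕ} (hy : y < 2 ^ m) :
    (cU m pts mm).testBit y = true ↔ ¬ ∃ j < pts.size, inFirst mm j = true ∧ pt m y ⊆ pt m (pts.getD j 0) := by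
  unfold cU
  rw [Nat.testBit_xor, testBit_full, (testBit_classDown pts mm y).1, decide_eq_true hy]
  simp only [Bool.true_xor, Bool.not_eq_true', List.any_eq_false, List.mem_range, Bool.and_eq_true, not_and]
  constructor
  · rintro h ⟨j, hj, hf, hsub⟩
    have h1 := h j hj hf
    rw [testBit_subT m (hpts j hj), decide_eq_true hy, Bool.true_and, (sub_eq_true_iff _ hy)] at h1
    exact h1 hsub
  · intro h j hj hf hbit
    rw [testBit_subT m (hpts j hj), decide_eq_true hy, Bool.true_and, (sub_eq_true_iff _ hy)] at hbit
    exact h ⟨j, hj, hf, hbit⟩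

/-- Bits of `cV` (codes `< 2^m`): not below a second-class point. [this work] -/
theorem testBit_cV_iff {pts : Array ℕ} (hpts : PtsLt m pts) (mm : ℕ) {y : ℕ} (hy : y < 2 ^ m) :
    (cV m pts mm).testBit y = true ↔ ¬ ∃ j < pts.size, inFirst mm j = false ∧ pt m y ⊆ pt m (pts.getD j 0) := by
  unfold cV
  rw [Nat.testBit_xor, testBit_full, (testBit_classDown pts mm y).2, decide_eq_true hy]
  simp only [Bool.true_xor, Bool.not_eq_true', List.any_eq_false, List.mem_range, Bool.and_eq_true, not_and]
  constructor
  · rintro h ⟨j, hj, hf, hsub⟩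
    have h1 := h j hj (by simp [hf])
    rw [testBit_subT m (hpts j hj), decide_eq_true hy, Bool.true_and, (sub_eq_true_iff _ hy)] at h1
    exact h1 hsub
  · intro h j hj hf hbit
    rw [testBit_subT m (hpts j hj), decide_eq_true hy, Bool.true_and, (sub_eq_true_iff _ hy)] at hbit
    have hf' : inFirst mm j = false := by cases h' : inFirst mm j <;> simp_all
    exact h ⟨j, hj, hf', hbit⟩

/-- `cU < 2^(2^m)`. [this work] -/
theorem cU_lt' (m : ℕ) (pts : Array ℕ) (mm : ℕ) : cU m pts mm < 2 ^ (2 ^ m) := Nat.xor_lt_two_pow (full_lt m) (classDown_lt m pts mm).1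

/-- `cV < 2^(2^m)`. [this work] -/
theorem cV_lt' (m : ℕ) (pts : Array ℕ) (mm : ℕ) : cV m pts mm < 2 ^ (2 ^ m) := Nat.xor_lt_two_pow (full_lt m) (classDown_lt m pts mm).2

/-! ### Represented pairs -/

/-- `Repr m A B pts mm`: the coloured node `(pts, mm)` represents the pair `(A, B)` — codes `< 2^m`, first class = `coGen A`, second class =
`coGen B` (as points). [this work] -/
structure Repr (m : ℕ) (A B : Finset (Set (Fin m))) (pts : Array ℕ) (mm : ℕ) : Prop where
  lt : PtsLt m pts
  cls1 : ∀ a, a ∈ PairSat.coGen A ↔ ∃ j < pts.size, inFirst mm j = true ∧ pt m (pts.getD j 0) = a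
  cls2 : ∀ b, b ∈ PairSat.coGen B ↔ ∃ j < pts.size, inFirst mm j = false ∧ pt m (pts.getD j 0) = b

/-- Two masks below `2^(2^m)` with the same bits below `2^m` are equal. [this work] -/
theorem eq_of_testBit_eq_below {a b : ℕ} (ha : a < 2 ^ (2 ^ m)) (hb : b < 2 ^ (2 ^ m)) (h : ∀ y < 2 ^ m, a.testBit y = b.testBit y) :
    a = b := by
  refine Nat.eq_of_testBit_eq fun y => ?_
  by_cases hy : y < 2 ^ m
  · exact h y hy
  · have hle : 2 ^ (2 ^ m) ≤ 2 ^ y := Nat.pow_le_pow_right (by norm_num) (not_lt.1 hy)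
    rw [Nat.testBit_lt_two_pow (lt_of_lt_of_le ha hle), Nat.testBit_lt_two_pow (lt_of_lt_of_le hb hle)]

/-- **The first mask is the first up-set.** [this work] -/
theorem cU_eq_encA {A B : Finset (Set (Fin m))} {pts : Array ℕ} {mm : ℕ} (hR : Repr m A B pts mm) (hA : IsUpperSet (A : Set (Set (Fin m)))) :
    cU m pts mm = encA m ↑A := by
  refine eq_of_testBit_eq_below (cU_lt' m pts mm) (encA_lt m _) fun y hy => ?_
  rw [testBit_encA_of_lt _ hy]
  by_cases hyA : pt m y ∈ A
  · have e : @decide (pt m y ∈ (↑A : Set (Set (Fin m)))) (Classical.propDecidable _) = true := @decide_eq_true _ (Classical.propDecidable _) hyA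
    rw [e, testBit_cU_iff hR.lt mm hy]
    rintro ⟨j, hj, hf, hsub⟩
    exact PairSat.not_mem_of_le_of_mem_coGen hA ((hR.cls1 _).2 ⟨j, hj, hf, rfl⟩) hsub hyA
  · have e : @decide (pt m y ∈ (↑A : Set (Set (Fin m)))) (Classical.propDecidable _) = false := @decide_eq_false _ (Classical.propDecidable _) hyA
    rw [e, Bool.eq_false_iff]
    intro hbit
    rw [testBit_cU_iff hR.lt mm hy] at hbit
    obtain ⟨a, ha, hya⟩ := PairSat.exists_coGen_ge_of_not_mem hyA
    obtain ⟨j, hj, hf, rfl⟩ := (hR.cls1 a).1 ha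
    exact hbit ⟨j, hj, hf, hya⟩

/-- **The second mask is the second up-set.** [this work] -/
theorem cV_eq_encA {A B : Finset (Set (Fin m))} {pts : Array ℕ} {mm : ℕ} (hR : Repr m A B pts mm) (hB : IsUpperSet (B : Set (Set (Fin m)))) :
    cV m pts mm = encA m ↑B := by
  refine eq_of_testBit_eq_below (cV_lt' m pts mm) (encA_lt m _) fun y hy => ?_
  rw [testBit_encA_of_lt _ hy]
  by_cases hyB : pt m y ∈ B
  · have e : @decide (pt m y ∈ (↑B : Set (Set (Fin m)))) (Classical.propDecidable _) = true := @decide_eq_true _ (Classical.propDecidable _) hyB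
    rw [e, testBit_cV_iff hR.lt mm hy]
    rintro ⟨j, hj, hf, hsub⟩
    exact PairSat.not_mem_of_le_of_mem_coGen hB ((hR.cls2 _).2 ⟨j, hj, hf, rfl⟩) hsub hyB
  · have e : @decide (pt m y ∈ (↑B : Set (Set (Fin m)))) (Classical.propDecidable _) = false := @decide_eq_false _ (Classical.propDecidable _) hyB
    rw [e, Bool.eq_false_iff]
    intro hbit
    rw [testBit_cV_iff hR.lt mm hy] at hbit
    obtain ⟨b, hb, hyb⟩ := PairSat.exists_coGen_ge_of_not_mem hyB
    obtain ⟨j, hj, hf, rfl⟩ := (hR.cls2 b).1 hb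
    exact hbit ⟨j, hj, hf, hyb⟩

/-! ### Free points and their down-set -/

/-- Elements of the code array, by index. [this work] -/
theorem mem_toList_iff (pts : Array ℕ) (x : ℕ) : x ∈ pts.toList ↔ ∃ j < pts.size, pts.getD j 0 = x := by
  rw [Array.mem_toList_iff, Array.mem_iff_getElem]
  constructor
  · rintro ⟨j, hj, rfl⟩; exact ⟨j, hj, by rw [Array.getD_eq_getD_getElem?, Array.getElem?_eq_getElem hj]; rfl⟩
  · rintro ⟨j, hj, rfl⟩; exact ⟨j, hj, by rw [Array.getD_eq_getD_getElem?, Array.getElem?_eq_getElem hj]; rfl⟩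

/-- The points of a represented node are exactly `coGen A ∪ coGen B`. [this work] -/
theorem Repr.mem_union_iff {A B : Finset (Set (Fin m))} {pts : Array ℕ} {mm : ℕ} (hR : Repr m A B pts mm) (z : Set (Fin m)) :
    z ∈ PairSat.coGen A ∪ PairSat.coGen B ↔ ∃ j < pts.size, pt m (pts.getD j 0) = z := by
  rw [mem_union, hR.cls1, hR.cls2]
  constructor
  · rintro (⟨j, hj, _, h⟩ | ⟨j, hj, _, h⟩) <;> exact ⟨j, hj, h⟩
  · rintro ⟨j, hj, h⟩
    cases hf : inFirst mm j
    · exact Or.inr ⟨j, hj, hf, h⟩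
    · exact Or.inl ⟨j, hj, hf, h⟩

/-- Bits of `freeOf` (codes `< 2^m`): incomparable with every point. [this work] -/
theorem testBit_freeOf_iff {pts : Array ℕ} (hpts : PtsLt m pts) {z : ℕ} (hz : z < 2 ^ m) :
    (freeOf m pts).testBit z = true ↔ ∀ j < pts.size, ¬ pt m z ⊆ pt m (pts.getD j 0) ∧ ¬ pt m (pts.getD j 0) ⊆ pt m z := by
  unfold freeOf
  rw [Nat.testBit_xor, Nat.testBit_land, testBit_full, decide_eq_true hz, orTab_eq_pair43, testBit_orTab]
  simp only [Bool.true_and, Bool.true_xor, Bool.not_eq_true', List.any_eq_false]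
  constructor
  · intro h j hj
    have h1 := h (pts.getD j 0) ((mem_toList_iff pts _).2 ⟨j, hj, rfl⟩)
    rw [testBit_cmpT m (hpts j hj), decide_eq_true hz, Bool.true_and, Bool.or_eq_true, sub_eq_true_iff _ hz,
      sub_eq_true_iff _ (hpts j hj)] at h1
    exact not_or.1 h1
  · intro h x hx
    obtain ⟨j, hj, rfl⟩ := (mem_toList_iff pts x).1 hx
    rw [testBit_cmpT m (hpts j hj), decide_eq_true hz, Bool.true_and, Bool.or_eq_true, sub_eq_true_iff _ hz,
      sub_eq_true_iff _ (hpts j hj)]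
    exact not_or.2 (h j hj)

/-- **The free points of a represented node are the `Free` points w.r.t. `coGen A ∪ coGen B`.** [this work] -/
theorem free_iff_testBit_freeOf {A B : Finset (Set (Fin m))} {pts : Array ℕ} {mm : ℕ} (hR : Repr m A B pts mm) (q : Set (Fin m)) :
    PairSat.Free (PairSat.coGen A ∪ PairSat.coGen B) q ↔ (freeOf m pts).testBit (encS q) = true := by
  rw [testBit_freeOf_iff hR.lt (encS_lt q), pt_encS]
  unfold PairSat.Free
  constructor
  · intro h j hj
    have := h _ ((hR.mem_union_iff _).2 ⟨j, hj, rfl⟩)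
    exact this
  · intro h z hz
    obtain ⟨j, hj, rfl⟩ := (hR.mem_union_iff z).1 hz
    exact h j hj

/-- **Every code below a free point lies in `dFOf`.** [this work] -/
theorem testBit_dFOf_of_le_free {A B : Finset (Set (Fin m))} {pts : Array ℕ} {mm : ℕ} (hR : Repr m A B pts mm) {y : ℕ} (hy : y < 2 ^ m)
    {q : Set (Fin m)} (hq : PairSat.Free (PairSat.coGen A ∪ PairSat.coGen B) q) (hyq : pt m y ⊆ q) : (dFOf m pts).testBit y = true := by
  unfold dFOf
  rw [testBit_orBits, List.any_eq_true]
  refine ⟨encS q, List.mem_range.2 (by rw [np_eq]; exact encS_lt q), ?_⟩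
  rw [Bool.and_eq_true, (free_iff_testBit_freeOf hR q).1 hq, testBit_subT m (encS_lt q), decide_eq_true hy, Bool.true_and,
    sub_eq_true_iff _ hy, pt_encS]
  exact ⟨rfl, hyq⟩

end Summit.CriticalPhenomena.PercolationContinuityZ3.Theorems.ThreePartition.Cube
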